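import Mathlib
import HarnessLib
import Summits.HubbardSuperconductivity.HubbardSuperconductivity.Theorems.KLProgrammeKLRegimeEngineValueClauseReductionV9
import Summits.HubbardSuperconductivity.HubbardSuperconductivity.Theorems.KLProgrammeKLRegimeSplitPairLadder

/-!
# K3 engine child (`KLRegimeEngineV14`, stmt-HubbardSuperconductivity-19918), stub `stub_engine_step_values`: the IN-CLASS pair-value increment
# (E2″-v6) is a COROLLARY of the pair-ladder step (E2-v9) + the history's ball envelope (B1-v2′) + ONE package inequality
# (cell gate-hubbard-kl, seat hubbard-kl-k3c2-p2 «thermal-bar induction n ≤ nScales β + 1»; value-clause reduction lane `klvr_`/`klvr9_`)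

At a total momentum `Qm` in the pair class at resolution `n ≥ 1`, (E2-v9) `PairLadderStepAtV9 … n` supplies a rung weight `w` (`Σ|w| ≤ G.bhi`) and
a resolvent `N` with `(1 + diag(w)·A)·N = 1`, `A = klPairArray … (n−1) Qm` (the ball-TRUNCATED pair array of the previous scale), and bounds
`𝒞_n(k,k′) − (A·N)(k,k′)` on the ball by the (E2-v9) budget `B_v9`.  The history's split clause (B1-v2′) `PairArrayAtV2 … (n−1)` puts every
ball entry of `A` in an envelope `‖A(k,p)‖ ≤ E := 2|U| + (C_W + klLegKappa·Q.CR·Klam³)·U²`.  Pure matrix algebra (push-through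
`A·N − A = −A·diag(w)·(A·N)` and a max-row fixed point, §1) then gives `‖(A·N − A)(k,k′)‖ ≤ E²·Σ|w|/(1 − E·Σ|w|)`, hence

`‖𝒞_n(Qm;k,k′) − 𝒞_{n−1}(Qm;k,k′)‖ ≤ B_v9(k,k′) + E²·bhi/(1 − E·bhi)`  on the ball,

which is the (E2″-v6) inequality `PairValueIncrementAtV6` AT THIS `Qm` as soon as `(Klam U)²·G.ppGain n |Qm|_𝕋 ≥ drivePBar(n−1) + E²bhi/(1 − E·bhi)`
— with `Klam ≥ 1`, `(C_W + klLegKappa·Q.CR·Klam³)|U| ≤ 1/10`, `|U|·bhi ≤ 1/8` this is **`G.aplus·G.ζ(n−1) + 10·G.bhi ≤ G.ppGain n |Qm|_𝕋`**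
(`klvr10_pairValueIncrement_inClass`).  At the package of record `klEngGeo3/4` (`ppGain ≤ 1`, `bhi = 2^24`) the inequality FAILS — this is the
`min 1` cap of NIT-κg; at the gains rider `klEngGeo5 := klEngGeo4.scaleGains (2^28)` (HOME/hubbard-kl-k3c2-p2/…DefsG5.draft.lean) it reads
`2^24·2^{−(n−1)} + 10·2^24 ≤ 2^28` ✓ at every `n ≥ 1`, so in class (E2″-v6) — and with `klvr_quarticValueIncrementAtS3_of_pairValueIncrementAtV6`
(E2′-S3) — stop being separate expansion obligations of `stub_engine_step_values`: only the OUT-OF-CLASS transfers (where (E2-v9) is silent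
and `ppGain < κg` carries the two-shell transversality gain) remain for the expansion.

* §1 `klvr10_pushThrough`, `klvr10_resolvent_entry_le`, `klvr10_increment_entry_le` — generic over a `Fintype` index and a finset `S` outside
  which `A` vanishes;
* §2 `klvr10_klPairArray_zero_fst/_snd`, `klvr10_pairArray_envelope` (from `PairArrayAtV2`), **`klvr10_pairValueIncrement_inClass_of_ladder`**
  (generic `E`, `m`), **`klvr10_pairValueIncrement_inClass`** (the numeric form above).

Pure algebra over the route's predicates; nothing about the model is asserted.
-/

noncomputable section

namespace Summit.HubbardSuperconductivity.HubbardSuperconductivity.Theorems.KLRegimeSplit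

set_option linter.dupNamespace false -- summit = problem name (single-conjunct summit), D-0017

open Real Finset Literature.MathematicalPhysics.QuantumLattice Literature.Probability.LatticeModels
open Summit.HubbardSuperconductivity.HubbardSuperconductivity.Theorems.KLProgrammeLegKernels

/-! ## §1 Matrix algebra: push-through and the max-row fixed point -/

section MatrixAlgebra

variable {ι : Type*} [Fintype ι] [DecidableEq ι] {A N : Matrix ι ι ℂ} {w : ι → ℝ}

/-- **Push-through**: `(1 + diag(w)·A)·N = 1 ⟹ A·N = A − A·diag(w)·(A·N)`. -/
theorem klvr10_pushThrough (hN : (1 + Matrix.diagonal (fun p => (w p : ℂ)) * A) * N = 1) :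
    A * N = A - A * Matrix.diagonal (fun p => (w p : ℂ)) * (A * N) := by
  have h : A * ((1 + Matrix.diagonal (fun p => (w p : ℂ)) * A) * N) =
      A * N + A * Matrix.diagonal (fun p => (w p : ℂ)) * (A * N) := by
    simp only [Matrix.add_mul, Matrix.mul_add, Matrix.one_mul, Matrix.mul_assoc]
  rw [hN, Matrix.mul_one] at h
  exact eq_sub_of_add_eq h.symm

/-- Entries of `A·diag(w)·X`: `(A·diag(w)·X)(p,k) = Σ_q A(p,q)·w(q)·X(q,k)`. -/
theorem klvr10_mul_diagonal_mul_apply (A X : Matrix ι ι ℂ) (w : ι → ℝ) (p k : ι) :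
    (A * Matrix.diagonal (fun p => (w p : ℂ)) * X) p k = ∑ q, A p q * (w q : ℂ) * X q k := by
  rw [Matrix.mul_apply]
  refine sum_congr rfl fun q _ => ?_
  rw [Matrix.mul_diagonal]

/-- **The max-row fixed point**: if the columns of `A` vanish off `S`, `‖A(p,q)‖ ≤ E` on `S × S` (`E ≥ 0`), `Σ|w| ≤ m`, `E·m < 1`, and
`(1 + diag(w)·A)·N = 1`, then every ball row of the resolvent array is in the inflated envelope: `‖(A·N)(p,k)‖ ≤ E/(1 − E·m)` for `p ∈ S`
and every `k`. -/
theorem klvr10_resolvent_entry_le (hN : (1 + Matrix.diagonal (fun p => (w p : ℂ)) * A) * N = 1) {S : Finset ι}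
    (hA2 : ∀ p q, q ∉ S → A p q = 0) {E m : ℝ} (hE0 : 0 ≤ E)
    (hE : ∀ p ∈ S, ∀ q ∈ S, ‖A p q‖ ≤ E) (hm : ∑ q, |w q| ≤ m) (hEm : E * m < 1) (k : ι) :
    ∀ p ∈ S, ‖(A * N) p k‖ ≤ E / (1 - E * m) := by
  set X := A * N with hX
  have hm0 : 0 ≤ m := le_trans (sum_nonneg fun q _ => abs_nonneg _) hm
  by_cases hS : S.Nonempty
  · obtain ⟨p₀, hp₀, hmax⟩ := exists_max_image S (fun p => ‖X p k‖) hS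
    set x := ‖X p₀ k‖ with hx
    -- every entry of `A` in row `p₀` is `≤ E` in norm (zero off `S`)
    have hArow : ∀ q, ‖A p₀ q‖ ≤ E := fun q => by
      by_cases hq : q ∈ S
      · exact hE p₀ hp₀ q hq
      · rw [hA2 p₀ q hq, norm_zero]; exact hE0
    -- every entry of `X` in column `k` with row in `S` is `≤ x`; rows off `S` vanish
    have hXcol : ∀ q, ‖A p₀ q‖ * |w q| * ‖X q k‖ ≤ E * x * |w q| := fun q => by
      by_cases hq : q ∈ S
      · have h1 := hmax q hq
        have h2 := hArow q
        calc ‖A p₀ q‖ * |w q| * ‖X q k‖ ≤ E * |w q| * x :=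
              mul_le_mul (mul_le_mul_of_nonneg_right h2 (abs_nonneg _)) h1 (norm_nonneg _) (by positivity)
          _ = E * x * |w q| := by ring
      · rw [hA2 p₀ q hq, norm_zero, zero_mul, zero_mul]; positivity
    -- the fixed-point inequality `x ≤ E + E·m·x`
    have hfix : x ≤ E + E * m * x := by
      have h := congrFun (congrFun (klvr10_pushThrough hN) p₀) k
      rw [Matrix.sub_apply, klvr10_mul_diagonal_mul_apply] at h
      have hsum : ‖∑ q, A p₀ q * (w q : ℂ) * (A * N) q k‖ ≤ E * m * x := by
        refine (norm_sum_le _ _).trans ?_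
        calc ∑ q, ‖A p₀ q * (w q : ℂ) * (A * N) q k‖ = ∑ q, ‖A p₀ q‖ * |w q| * ‖X q k‖ := by
              refine sum_congr rfl fun q _ => ?_
              rw [norm_mul, norm_mul, Complex.norm_real, Real.norm_eq_abs]
          _ ≤ ∑ q, E * x * |w q| := sum_le_sum fun q _ => hXcol q
          _ = E * x * ∑ q, |w q| := by rw [mul_sum]
          _ ≤ E * x * m := mul_le_mul_of_nonneg_left hm (by positivity)
          _ = E * m * x := by ring
      calc x = ‖(A * N) p₀ k‖ := by rw [hx]
        _ = ‖A p₀ k - ∑ q, A p₀ q * (w q : ℂ) * (A * N) q k‖ := by rw [h]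
        _ ≤ ‖A p₀ k‖ + ‖∑ q, A p₀ q * (w q : ℂ) * (A * N) q k‖ := norm_sub_le _ _
        _ ≤ E + E * m * x := add_le_add (hArow k) hsum
    have hden : 0 < 1 - E * m := by linarith
    have hxle : x ≤ E / (1 - E * m) := by
      rw [le_div_iff₀ hden]; nlinarith
    intro p hp
    exact (hmax p hp).trans hxle
  · intro p hp
    exact absurd ⟨p, hp⟩ hS

/-- **The ladder correction on the ball**: under the same hypotheses, `‖(A·N)(k,k′) − A(k,k′)‖ ≤ E·m·(E/(1 − E·m))` for `k ∈ S`. -/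
theorem klvr10_increment_entry_le (hN : (1 + Matrix.diagonal (fun p => (w p : ℂ)) * A) * N = 1) {S : Finset ι}
    (hA2 : ∀ p q, q ∉ S → A p q = 0) {E m : ℝ} (hE0 : 0 ≤ E)
    (hE : ∀ p ∈ S, ∀ q ∈ S, ‖A p q‖ ≤ E) (hm : ∑ q, |w q| ≤ m) (hEm : E * m < 1) {k : ι} (hk : k ∈ S) (k' : ι) :
    ‖(A * N) k k' - A k k'‖ ≤ E * m * (E / (1 - E * m)) := by
  have hm0 : 0 ≤ m := le_trans (sum_nonneg fun q _ => abs_nonneg _) hm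
  have hres := klvr10_resolvent_entry_le hN hA2 hE0 hE hm hEm k'
  have h := congrFun (congrFun (klvr10_pushThrough hN) k) k'
  rw [Matrix.sub_apply, klvr10_mul_diagonal_mul_apply] at h
  rw [h, sub_sub_cancel_left, norm_neg]
  refine (norm_sum_le _ _).trans ?_
  have hterm : ∀ q, ‖A k q * (w q : ℂ) * (A * N) q k'‖ ≤ E * (E / (1 - E * m)) * |w q| := fun q => by
    rw [norm_mul, norm_mul, Complex.norm_real, Real.norm_eq_abs]
    by_cases hq : q ∈ S
    · calc ‖A k q‖ * |w q| * ‖(A * N) q k'‖ ≤ E * |w q| * (E / (1 - E * m)) :=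
            mul_le_mul (mul_le_mul_of_nonneg_right (hE k hk q hq) (abs_nonneg _)) (hres q hq) (norm_nonneg _) (by positivity)
        _ = E * (E / (1 - E * m)) * |w q| := by ring
    · rw [hA2 k q hq, norm_zero, zero_mul, zero_mul]
      have : 0 ≤ E / (1 - E * m) := div_nonneg hE0 (by linarith)
      positivity
  calc ∑ q, ‖A k q * (w q : ℂ) * (A * N) q k'‖ ≤ ∑ q, E * (E / (1 - E * m)) * |w q| := sum_le_sum fun q _ => hterm q
    _ = E * (E / (1 - E * m)) * ∑ q, |w q| := by rw [mul_sum]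
    _ ≤ E * (E / (1 - E * m)) * m := mul_le_mul_of_nonneg_left hm (mul_nonneg hE0 (div_nonneg hE0 (by linarith)))
    _ = E * m * (E / (1 - E * m)) := by ring

end MatrixAlgebra

/-! ## §2 The in-class (E2″-v6) from (E2-v9) + (B1-v2′) -/

section Model

variable {L M : ℕ} [NeZero L] [NeZero M]

/-- The truncated pair array vanishes off the ball (second index). -/
theorem klvr10_klPairArray_zero_snd (β U μ : ℝ) (K : TrigPolyC4v) (n : ℕ) (Q k : TorusSite 2 L) {k' : TorusSite 2 L}
    (hk' : k' ∉ klBall L μ K) : klPairArray L M β U μ K n Q k k' = 0 := by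
  simp [klPairArray, hk']

/-- **The ball envelope of the pair array from (B1-v2′)**: `PairArrayAtV2 … n` puts every ball entry of `klPairArray … n Qm` within
`E = 2|U| + (C_W + klLegKappa·Q.CR·Klam³)·U²` of `0`. -/
theorem klvr10_pairArray_envelope {P : SplitConsts} {Q : EngConsts} {β U μ : ℝ} {K : TrigPolyC4v} {n : ℕ}
    (harr : PairArrayAtV2 L M P Q β U μ K n) (Qm : TorusSite 2 L) :
    ∀ p ∈ klBall L μ K, ∀ q ∈ klBall L μ K,
      ‖klPairArray L M β U μ K n Qm p q‖ ≤ 2 * |U| + (P.C_W + klLegKappa * Q.CR * P.Klam ^ 3) * U ^ 2 := by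
  intro p hp q hq
  obtain ⟨u, hu0, hu2, hclose⟩ := harr Qm
  rw [klPairArray_apply_of_mem L M β U μ K n Qm hp hq]
  have h := hclose p hp q hq
  have hu : ‖(u : ℂ)‖ ≤ 2 * |U| := by rw [Complex.norm_real, Real.norm_of_nonneg hu0]; exact hu2
  calc ‖klPairAmplitude L M β U μ K n Qm p q‖
      = ‖(klPairAmplitude L M β U μ K n Qm p q - (u : ℂ)) + (u : ℂ)‖ := by rw [sub_add_cancel]
    _ ≤ ‖klPairAmplitude L M β U μ K n Qm p q - (u : ℂ)‖ + ‖(u : ℂ)‖ := norm_add_le _ _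
    _ ≤ _ := by linarith

/-- **In-class (E2″-v6) from (E2-v9), generic form.**  At `n ≥ 1` and `Qm` in the pair class at resolution `n`: from `PairLadderStepAtV9 … n`,
`PairArrayAtV2 … (n−1)`, the envelope size `E := 2|U| + (C_W + klLegKappa·Q.CR·Klam³)U²` with `E·bhi < 1`, and the package inequality
`drivePBar(n−1) + E·bhi·(E/(1 − E·bhi)) ≤ (Klam U)²·ppGain n |Qm|_𝕋`, the pair-value increment obeys the (E2″-v6) budget at this `Qm`. -/
theorem klvr10_pairValueIncrement_inClass_of_ladder {G : GeoConsts} {P : SplitConsts} {Q : EngConsts} {β U μ : ℝ} {K : TrigPolyC4v}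
    {n : ℕ} (hn : 1 ≤ n) (hlad : PairLadderStepAtV9 L M G P Q β U μ K n) (harr : PairArrayAtV2 L M P Q β U μ K (n - 1))
    {Qm : TorusSite 2 L} (hQm : IsPairClassAt L Qm n)
    (hEm : (2 * |U| + (P.C_W + klLegKappa * Q.CR * P.Klam ^ 3) * U ^ 2) * G.bhi < 1)
    (hgain : drivePBar G P U (n - 1) +
        (2 * |U| + (P.C_W + klLegKappa * Q.CR * P.Klam ^ 3) * U ^ 2) * G.bhi *
          ((2 * |U| + (P.C_W + klLegKappa * Q.CR * P.Klam ^ 3) * U ^ 2) /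
            (1 - (2 * |U| + (P.C_W + klLegKappa * Q.CR * P.Klam ^ 3) * U ^ 2) * G.bhi)) ≤
      (P.Klam * U) ^ 2 * G.ppGain n (klTorusNorm L Qm)) :
    ∀ k ∈ klBall L μ K, ∀ k' ∈ klBall L μ K,
      ‖klPairAmplitude L M β U μ K n Qm k k' - klPairAmplitude L M β U μ K (n - 1) Qm k k'‖ ≤
        gainBar G P U n (klTorusNorm L Qm) (klTorusNorm L (k - k')) (klTorusNorm L (k + k' - Qm)) +
          eremBar G P Q U β L (n - 1) + thermalBar G P U β n +
            legDressBarQ G P Q U n (legSliceCountT L β μ K n ![k', Qm - k', Qm - k, k]) := by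
  intro k hk k' hk'
  set E : ℝ := 2 * |U| + (P.C_W + klLegKappa * Q.CR * P.Klam ^ 3) * U ^ 2 with hEdef
  set A := klPairArray L M β U μ K (n - 1) Qm with hAdef
  obtain ⟨w, hw1, hw2, N, hN, hb⟩ := hlad.2 hn Qm hQm
  -- the envelope and the truncation of `A`
  have hE0 : 0 ≤ E := by
    have h := klvr10_pairArray_envelope harr Qm k hk k hk
    exact (norm_nonneg _).trans h
  have hA2 : ∀ p q, q ∉ klBall L μ K → A p q = 0 := fun p q hq => klvr10_klPairArray_zero_snd β U μ K (n - 1) Qm p hq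
  have hEnv : ∀ p ∈ klBall L μ K, ∀ q ∈ klBall L μ K, ‖A p q‖ ≤ E := klvr10_pairArray_envelope harr Qm
  -- the ladder correction
  have hcorr := klvr10_increment_entry_le hN hA2 hE0 hEnv hw1 hEm hk k'
  have hAkk : A k k' = klPairAmplitude L M β U μ K (n - 1) Qm k k' := klPairArray_apply_of_mem L M β U μ K (n - 1) Qm hk hk'
  -- the (E2-v9) step bound
  have hstep := hb k hk k' hk'
  -- assemble
  have htri : ‖klPairAmplitude L M β U μ K n Qm k k' - klPairAmplitude L M β U μ K (n - 1) Qm k k'‖ ≤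
      ‖klPairAmplitude L M β U μ K n Qm k k' - (A * N) k k'‖ + ‖(A * N) k k' - A k k'‖ := by
    rw [← hAkk]
    exact norm_sub_le_norm_sub_add_norm_sub _ _ _
  refine htri.trans ?_
  refine (add_le_add hstep hcorr).trans ?_
  unfold gainBar
  nlinarith [hgain]

/-- **In-class (E2″-v6) from (E2-v9), package form.**  With `Klam ≥ 1`, the regime smallness `(C_W + klLegKappa·Q.CR·Klam³)·|U| ≤ 1/10` and
`|U|·G.bhi ≤ 1/8` (`G.bhi ≥ 0`), the single package inequality **`G.aplus·G.ζ (n−1) + 10·G.bhi ≤ G.ppGain n |Qm|_𝕋`** suffices. -/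
theorem klvr10_pairValueIncrement_inClass {G : GeoConsts} {P : SplitConsts} {Q : EngConsts} {β U μ : ℝ} {K : TrigPolyC4v}
    {n : ℕ} (hn : 1 ≤ n) (hlad : PairLadderStepAtV9 L M G P Q β U μ K n) (harr : PairArrayAtV2 L M P Q β U μ K (n - 1))
    {Qm : TorusSite 2 L} (hQm : IsPairClassAt L Qm n) (hK : 1 ≤ P.Klam) (hbhi : 0 ≤ G.bhi)
    (hcU : 0 ≤ P.C_W + klLegKappa * Q.CR * P.Klam ^ 3) (hcU' : (P.C_W + klLegKappa * Q.CR * P.Klam ^ 3) * |U| ≤ 1 / 10)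
    (hUb : |U| * G.bhi ≤ 1 / 8) (hgain : G.aplus * G.ζ (n - 1) + 10 * G.bhi ≤ G.ppGain n (klTorusNorm L Qm)) :
    ∀ k ∈ klBall L μ K, ∀ k' ∈ klBall L μ K,
      ‖klPairAmplitude L M β U μ K n Qm k k' - klPairAmplitude L M β U μ K (n - 1) Qm k k'‖ ≤
        gainBar G P U n (klTorusNorm L Qm) (klTorusNorm L (k - k')) (klTorusNorm L (k + k' - Qm)) +
          eremBar G P Q U β L (n - 1) + thermalBar G P U β n +
            legDressBarQ G P Q U n (legSliceCountT L β μ K n ![k', Qm - k', Qm - k, k]) := by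
  set c : ℝ := P.C_W + klLegKappa * Q.CR * P.Klam ^ 3 with hc
  set E : ℝ := 2 * |U| + c * U ^ 2 with hEdef
  have hU0 : 0 ≤ |U| := abs_nonneg U
  have hU2 : U ^ 2 = |U| ^ 2 := (sq_abs U).symm
  -- `E ≤ (21/10)|U|`
  have hEle : E ≤ 21 / 10 * |U| := by
    rw [hEdef, hU2]
    nlinarith [mul_nonneg hcU hU0]
  have hEge : 0 ≤ E := by rw [hEdef, hU2]; positivity
  -- `E·bhi ≤ 21/80 < 1`, so `1/(1 − E·bhi) ≤ 2`
  have hEb : E * G.bhi ≤ 21 / 80 := by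
    calc E * G.bhi ≤ 21 / 10 * |U| * G.bhi := mul_le_mul_of_nonneg_right hEle hbhi
      _ = 21 / 10 * (|U| * G.bhi) := by ring
      _ ≤ 21 / 10 * (1 / 8) := mul_le_mul_of_nonneg_left hUb (by norm_num)
      _ = 21 / 80 := by norm_num
  have hEm : E * G.bhi < 1 := by linarith
  have hden : 0 < 1 - E * G.bhi := by linarith
  -- the correction `E·bhi·E/(1 − E·bhi) ≤ 10·(Klam U)²·bhi`
  have hcorr : E * G.bhi * (E / (1 - E * G.bhi)) ≤ (P.Klam * U) ^ 2 * (10 * G.bhi) := by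
    have h1 : E / (1 - E * G.bhi) ≤ E / (59 / 80) := div_le_div_of_nonneg_left hEge (by norm_num) (by linarith)
    have h2 : E * G.bhi * (E / (1 - E * G.bhi)) ≤ E * G.bhi * (E / (59 / 80)) :=
      mul_le_mul_of_nonneg_left h1 (mul_nonneg hEge hbhi)
    refine h2.trans ?_
    have h3 : E * G.bhi * (E / (59 / 80)) = 80 / 59 * E ^ 2 * G.bhi := by ring
    rw [h3]
    have h4 : E ^ 2 ≤ (21 / 10) ^ 2 * |U| ^ 2 := by
      rw [← mul_pow]; exact pow_le_pow_left₀ hEge hEle 2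
    have h5 : |U| ^ 2 ≤ (P.Klam * U) ^ 2 := by
      rw [mul_pow, ← hU2]
      have h1K : (1 : ℝ) ≤ P.Klam ^ 2 := one_le_pow₀ hK
      calc U ^ 2 = 1 * U ^ 2 := (one_mul _).symm
        _ ≤ P.Klam ^ 2 * U ^ 2 := mul_le_mul_of_nonneg_right h1K (sq_nonneg U)
    nlinarith [mul_nonneg (sq_nonneg E) hbhi, mul_nonneg (sq_nonneg (P.Klam * U)) hbhi]
  -- the drive term `drivePBar(n−1) = aplus·(Klam U)²·ζ(n−1)`
  have hgain' : drivePBar G P U (n - 1) + E * G.bhi * (E / (1 - E * G.bhi)) ≤ (P.Klam * U) ^ 2 * G.ppGain n (klTorusNorm L Qm) := by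
    unfold drivePBar
    have hsq : 0 ≤ (P.Klam * U) ^ 2 := sq_nonneg _
    have h := mul_le_mul_of_nonneg_left hgain hsq
    nlinarith
  exact klvr10_pairValueIncrement_inClass_of_ladder hn hlad harr hQm hEm hgain'

end Model

end Summit.HubbardSuperconductivity.HubbardSuperconductivity.Theorems.KLRegimeSplit

end
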